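import Summits.HubbardSuperconductivity.HubbardSuperconductivity.Theses.LiebTwin
import HarnessLib

/-!
# Route `LiebTwin`, assembly (item `stmt-HubbardSuperconductivity-15662`)

Closes `Summit.HubbardSuperconductivity.HubbardSuperconductivity.Theses.LiebTwin.Assembly`:
`TwinOnsiteCondensation → DWavePolarisedDiscordance → NoOnsiteODLRO → RealFlipDefiniteSuffices →
LiebTwinFloor → UniformLROGivesSummitMatrix → HubbardSuperconductivity`.

Pure logic: the route's own DECIDING THEOREM `LiebTwin.closes` (elaborated with the route file) already
derives the summit from the three cruxes `TwinOnsiteCondensation`, `DWavePolarisedDiscordance`,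
`NoOnsiteODLRO` (rev 1 restated K2 and K3' over every normalised ground state precisely so that no
reduction lemma is needed), so the three support hypotheses are not consumed. No definition and no named
fact is introduced.
-/

-- the mandated namespace `Summit.<Summit>.<Problem>.Theorems` repeats `HubbardSuperconductivity`
-- (single-problem summit, D-0017), which the `dupNamespace` linter flags on every declaration
set_option linter.dupNamespace false

namespace Summit.HubbardSuperconductivity.HubbardSuperconductivity.Theorems

/-- **Assembly of route `LiebTwin`** (item `stmt-HubbardSuperconductivity-15662`): the cruxes K2
(`TwinOnsiteCondensation`), K3' (`DWavePolarisedDiscordance`) and `NoOnsiteODLRO`, together with the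
supports `RealFlipDefiniteSuffices`, `LiebTwinFloor`, `UniformLROGivesSummitMatrix`, imply the summit
statement `HubbardSuperconductivity` — by the route's deciding theorem `LiebTwin.closes`, which uses the
three cruxes only. [folklore] -/
theorem liebTwin_assembly_proof :
    Summit.HubbardSuperconductivity.HubbardSuperconductivity.Theses.LiebTwin.Assembly :=
  fun hK2 hK3 hNo _ _ _ =>
    Summit.HubbardSuperconductivity.HubbardSuperconductivity.Theses.LiebTwin.closes hK2 hK3 hNo

end Summit.HubbardSuperconductivity.HubbardSuperconductivity.Theorems
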